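import Literature.NumberTheory.QuadraticFields.QuadraticDedekindZetaKronecker
import Literature.NumberTheory.LFunctions.PrimitiveQuadraticCharacterKronecker
import HarnessLib

/-!
# `ζ_K(s) = ζ(s) L(s, χ)` for the odd real primitive character `χ` mod `d` and the imaginary quadratic
# field `K` of discriminant `−d`

Topic `NumberTheory/QuadraticFields`, namespace `Literature.NumberTheory.QuadraticFields.Quadratic`
(continuing `QuadraticDedekindZetaKronecker.lean`: `ζ_K = ζ · L(κ)` for every quadratic field and every
`κ` with the Kronecker values). Everything here is PROVED (theorems only, no definitions, no named
facts).

For a primitive quadratic odd Dirichlet character `χ` mod `d` (the datum of the Siegel-zero statements,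
e.g. `Literature.NumberTheory.DiophantineGeometry.NoSiegelZerosOddQuadratic`):

* `kroneckerValues_of_odd_primitive` — `χ` has the Kronecker values of `−d`: `χ(p) = (−d/p)` at odd
  primes and `χ(2) = 1, −1, 0` according as `−d ≡ 1, 5 (mod 8)` or `d` is even
  (`PrimitiveQuadraticCharacterKronecker.lean`, Montgomery–Vaughan Thm. 9.13);
* `dedekindZeta_eq_riemannZeta_mul_LFunction_of_odd_primitive` — **for `K` quadratic with `d_K = −d`,
  `ζ_K(s) = ζ(s) L(s, χ)`** (`Re s > 1`), by `dedekindZeta_eq_riemannZeta_mul_LSeries_of_kronecker`;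
* `exists_quadraticField_of_odd_primitive` — such a `K` exists (`−d` is a fundamental discriminant,
  `PrimitiveQuadratic.isFundamentalDiscriminant_neg`, and `exists_numberField_discr_eq`).

## References

* [MontgomeryVaughan2007] H. L. Montgomery, R. C. Vaughan, *Multiplicative Number Theory I*, §9.3
  Thm. 9.13, §10.1 Exercise 26.
-/

noncomputable section

open Module NumberField
open scoped NumberTheorySymbols

namespace Literature.NumberTheory.QuadraticFields.Quadratic

open Literature.NumberTheory.LFunctions.PrimitiveQuadratic

/-- **An odd real primitive character mod `d` has the Kronecker values of `−d`**: `χ(p) = (−d/p)`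
for odd primes `p`, and `χ(2) = 1, −1, 0` according as `−d ≡ 1, 5 (mod 8)` or otherwise.
[cite: MontgomeryVaughan2007, Theorem 9.13] -/
theorem kroneckerValues_of_odd_primitive {d : ℕ} [NeZero d] {χ : DirichletCharacter ℂ d}
    (hprim : χ.IsPrimitive) (hquad : χ.IsQuadratic) (hodd : χ.Odd) :
    (∀ p : ℕ, p.Prime → p ≠ 2 → χ p = (J(-(d : ℤ) | p) : ℂ)) ∧
      χ 2 = (if (-(d : ℤ)) % 8 = 1 then 1 else if (-(d : ℤ)) % 8 = 5 then -1 else 0) := by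
  refine ⟨fun p hp hp2 => apply_natCast_eq_jacobiSym_neg_of_odd hprim hquad hodd (hp.odd_of_ne_two hp2),
    ?_⟩
  rcases Nat.even_or_odd d with he | ho
  · have h4 : 4 ∣ d := four_dvd_of_isPrimitive_of_even he hprim
    have h1 : ¬ (-(d : ℤ)) % 8 = 1 := by omega
    have h5 : ¬ (-(d : ℤ)) % 8 = 5 := by omega
    rw [if_neg h1, if_neg h5]
    exact apply_two_of_even he χ
  · have hq3 := mod_four_eq_three_of_odd ho hprim hquad hodd
    by_cases h1 : (-(d : ℤ)) % 8 = 1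
    · rw [if_pos h1]
      exact apply_two_eq_one_of_odd ho hprim hquad hodd h1
    · have h5 : (-(d : ℤ)) % 8 = 5 := by omega
      rw [if_neg h1, if_pos h5]
      exact apply_two_eq_neg_one_of_odd ho hprim hquad hodd h5

variable {K : Type*} [Field K] [NumberField K]

/-- **`ζ_K(s) = ζ(s) L(s, χ)` for the odd real primitive character mod `d` and the imaginary
quadratic field of discriminant `−d`.** If `χ` is a primitive quadratic odd Dirichlet character mod
`d` and `K` is a quadratic field with `d_K = −d`, then `ζ_K(s) = ζ(s) L(s, χ)` for `Re s > 1`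
(`dedekindZeta_eq_riemannZeta_mul_LSeries_of_kronecker` with `kroneckerValues_of_odd_primitive`).
[cite: MontgomeryVaughan2007, §10.1 Exercise 26] -/
theorem dedekindZeta_eq_riemannZeta_mul_LFunction_of_odd_primitive {d : ℕ} [NeZero d]
    {χ : DirichletCharacter ℂ d} (hprim : χ.IsPrimitive) (hquad : χ.IsQuadratic) (hodd : χ.Odd)
    (h2 : finrank ℚ K = 2) (hdisc : NumberField.discr K = -(d : ℤ)) {s : ℂ} (hs : 1 < s.re) :
    NumberField.dedekindZeta K s = riemannZeta s * χ.LFunction s := by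
  obtain ⟨hoddp, htwo⟩ := kroneckerValues_of_odd_primitive hprim hquad hodd
  rw [DirichletCharacter.LFunction_eq_LSeries χ hs]
  refine dedekindZeta_eq_riemannZeta_mul_LSeries_of_kronecker h2 χ (fun p hp hp2 => ?_) ?_ hs
  · rw [hdisc]
    exact hoddp p hp hp2
  · rw [hdisc]
    exact htwo

omit [NumberField K] [Field K] in
/-- **The imaginary quadratic field of an odd real primitive character.** If `χ` is a primitive
quadratic odd Dirichlet character mod `d`, there is a quadratic field `K` with `d_K = −d` (`−d` is a
fundamental discriminant, `PrimitiveQuadratic.isFundamentalDiscriminant_neg`, and every fundamental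
discriminant is a field discriminant, `exists_numberField_discr_eq`).
[cite: MontgomeryVaughan2007, Theorem 9.13] -/
theorem exists_quadraticField_of_odd_primitive {d : ℕ} [NeZero d] {χ : DirichletCharacter ℂ d}
    (hprim : χ.IsPrimitive) (hquad : χ.IsQuadratic) (hodd : χ.Odd) :
    ∃ (K : Type) (_ : Field K) (_ : NumberField K),
      Module.finrank ℚ K = 2 ∧ NumberField.discr K = -(d : ℤ) :=
  exists_numberField_discr_eq (isFundamentalDiscriminant_neg hprim hquad hodd)

end Literature.NumberTheory.QuadraticFields.Quadratic
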